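import Summits.BirchSwinnertonDyer.Rank1Residual.TwoVariableOrdinaryMainConjecture
import Literature.NumberTheory.EllipticCurves.BurungaleCastellaSkinner2025.VexingPrimesMultiplicativeProofs
import HarnessLib

/-!
# Edges for the ordinary two-variable main conjecture leaf: BCS Thm. 1.4.1 (b) with its hypothesis
# "`V = ∅`" DISCHARGED on the semistable locus (PROOFS only)

Proof-only companion (theorems only; cell `bsd-littype`, seat 03, gen 4; D-0088(4)) of
`TwoVariableOrdinaryMainConjecture.lean` (same directory, gen 3: the obligation leaf
`OrdinaryTwoVariableMainConjectureAt` = Burungale–Castella–Skinner 2025 statement 4.1.1 AT a datum,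
with the edge `of_thm141_of_surj` = BCS Thm. 1.4.1 (b) on the locus `p > 3` good ordinary, (sur),
(Heeg), (spl), (disc), `V = ∅`, and `of_thm141_of_surj_of_forall_not_dvd` discharging "`V = ∅`" from
the congruence condition "no prime `ℓ ∣ N_E` has `p ∣ ℓ + 1`").  Since then the vexing set has been
bounded further IN THE KERNEL: `V ⊆ {ℓ prime : ℓ² ∣ N_E ∧ p ∣ ℓ + 1}` and `V = ∅` for every
SEMISTABLE `E/ℚ` (`Literature/…/BurungaleCastellaSkinner2025/VexingPrimesMultiplicativeProofs.lean`:
a prime of multiplicative reduction is never vexing — Tate curve; Silverman *ATAEC* Ex. 5.13 (a),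
Edixhoven §2).  This file records the resulting edges:

* `of_thm141_of_surj_of_isSemistable` — BCS Thm. 1.4.1 (b) gives statement 4.1.1 at `(E, K, p)` for
  every SEMISTABLE `E` under (sur), (Heeg), (spl), (disc), `p > 3`, with NO hypothesis on `V`;
* `of_thm141_of_surj_of_squarefree_conductorNorm` — the same with semistability read from the
  conductor (`N_E` squarefree);
* `of_thm141_of_surj_of_forall_sq_dvd_not_dvd` — the sharpened congruence criterion: it suffices that
  no prime `ℓ` with `ℓ² ∣ N_E` has `p ∣ ℓ + 1` (only additive primes can be vexing).

Nothing new is asserted: implications from the named fact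
`BurungaleCastellaSkinner2025.thm141_XOrd₂_isTorsion_charIdeal_eq_perrinRiou` to the `@[conjecture]`
predicate, through the proved theorems of `VexingPrimesMultiplicativeProofs.lean`.  HONEST FRAMING
(cell): "typed ≠ proved ≠ endorsed".

## References
* [BurungaleCastellaSkinner2025] IMRN 2025 rnaf082 = arXiv:2405.00270v2: Thm. 1.4.1 (b) and §1.4 (the
  set `V`, p. 4), statement 4.1.1 (p. 8).
* [SilvermanATAEC1994] Exercise 5.13 (a),(b) (the Tate-curve input of `V ⊆ {ℓ² ∣ N_E}`).
-/

noncomputable section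

open scoped Classical

open NumberField IsDedekindDomain Field CongruenceSubgroup
  Literature.NumberTheory.GaloisRepresentations Literature.NumberTheory.EllipticCurves
  Literature.NumberTheory.EllipticCurves.ModularForms Literature.NumberTheory.EllipticCurves.Rank1Residual
  Literature.NumberTheory.EllipticCurves.BurungaleCastellaSkinner2025

namespace Summit.BirchSwinnertonDyer.Rank1Residual.TwoVariableIMC

variable {p : ℕ} [Fact p.Prime] {K : Type} [Field K] [NumberField K]

/-- **BCS Thm. 1.4.1 (b) ⟹ statement 4.1.1 at `(E, K, p)` for SEMISTABLE `E`, no hypothesis on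
`V`**: for a semistable elliptic curve every prime is good or multiplicative, so no prime is vexing
(`vexingPrimes_eq_empty_of_isSemistable`), and Thm. 1.4.1 (b) applies under (sur), (Heeg), (spl),
(disc), `p > 3`. [cite: BurungaleCastellaSkinner2025, Thm. 1.4.1 (b) and §1.4 (the set V) (p. 4 of arXiv:2405.00270v2)]
[cite: SilvermanATAEC1994, Exercise 5.13(a) (PDF p. 416 of the held copy)] -/
theorem of_thm141_of_surj_of_isSemistable (h : thm141_XOrd₂_isTorsion_charIdeal_eq_perrinRiou)
    (ι : integralClosure ℚ ℂ →+* ℂ_[p]) (W : WeierstrassCurve ℚ) [W.IsElliptic] [W.IsGloballyMinimal]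
    (κ₁ κ₂ : ZpExtension K p) (γ₁ γ₂ : absoluteGaloisGroup K)
    [Fact (ZpExtension.IsTopGeneratorPair κ₁ κ₂ γ₁ γ₂)] {N : ℕ} [NeZero N]
    (π : ModularParametrizationData W N) (hp : 3 < p) (hord : GoodOrd W p)
    (hK : IsImaginaryQuadratic K) (hHeeg : SatisfiesHeegnerHypothesis N K)
    (hsplit : ((Ideal.span {(p : ℤ)}).primesOver (𝓞 K)).ncard = 2) (hodd : Odd (NumberField.discr K))
    (h3 : NumberField.discr K ≠ -3) (hss : W.IsSemistable (𝓞 ℚ)) (hsur : Surj W p) :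
    OrdinaryTwoVariableMainConjectureAt ι W K κ₁ κ₂ γ₁ γ₂ π :=
  of_thm141_of_surj h ι W κ₁ κ₂ γ₁ γ₂ π hp hord hK hHeeg hsplit hodd h3
    (vexingPrimes_eq_empty_of_isSemistable W hss) hsur

/-- **The same with semistability read from the conductor**: `N_E` squarefree ⟹ `V = ∅`
(`vexingPrimes_eq_empty_of_squarefree_conductorNorm`), so BCS Thm. 1.4.1 (b) gives statement 4.1.1
at `(E, K, p)` under (sur), (Heeg), (spl), (disc), `p > 3` and "`N_E` squarefree" alone.
[cite: BurungaleCastellaSkinner2025, Thm. 1.4.1 (b) and §1.4 (the set V) (p. 4 of arXiv:2405.00270v2)]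
[cite: Silverman1994, IV.10.2(b) (f_v = 1 ⟺ multiplicative reduction)] -/
theorem of_thm141_of_surj_of_squarefree_conductorNorm
    (h : thm141_XOrd₂_isTorsion_charIdeal_eq_perrinRiou) (ι : integralClosure ℚ ℂ →+* ℂ_[p])
    (W : WeierstrassCurve ℚ) [W.IsElliptic] [W.IsGloballyMinimal] (κ₁ κ₂ : ZpExtension K p)
    (γ₁ γ₂ : absoluteGaloisGroup K) [Fact (ZpExtension.IsTopGeneratorPair κ₁ κ₂ γ₁ γ₂)] {N : ℕ}
    [NeZero N] (π : ModularParametrizationData W N) (hp : 3 < p) (hord : GoodOrd W p)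
    (hK : IsImaginaryQuadratic K) (hHeeg : SatisfiesHeegnerHypothesis N K)
    (hsplit : ((Ideal.span {(p : ℤ)}).primesOver (𝓞 K)).ncard = 2) (hodd : Odd (NumberField.discr K))
    (h3 : NumberField.discr K ≠ -3) (hsq : Squarefree (W.conductorNorm ℤ)) (hsur : Surj W p) :
    OrdinaryTwoVariableMainConjectureAt ι W K κ₁ κ₂ γ₁ γ₂ π :=
  of_thm141_of_surj h ι W κ₁ κ₂ γ₁ γ₂ π hp hord hK hHeeg hsplit hodd h3
    (vexingPrimes_eq_empty_of_squarefree_conductorNorm W hsq) hsur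

/-- **The sharpened congruence criterion**: if no prime `ℓ` with `ℓ² ∣ N_E` satisfies `p ∣ ℓ + 1`,
then `V = ∅` (`vexingPrimes_eq_empty_of_forall_sq_dvd_not_dvd`: only additive primes can be vexing),
so BCS Thm. 1.4.1 (b) gives statement 4.1.1 at `(E, K, p)` under (sur), (Heeg), (spl), (disc),
`p > 3` and that arithmetic condition alone — strictly weaker than the gen-3 criterion over all
`ℓ ∣ N_E` (`of_thm141_of_surj_of_forall_not_dvd`).
[cite: BurungaleCastellaSkinner2025, Thm. 1.4.1 (b) and §1.4 (the set V) (p. 4 of arXiv:2405.00270v2)] -/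
theorem of_thm141_of_surj_of_forall_sq_dvd_not_dvd
    (h : thm141_XOrd₂_isTorsion_charIdeal_eq_perrinRiou) (ι : integralClosure ℚ ℂ →+* ℂ_[p])
    (W : WeierstrassCurve ℚ) [W.IsElliptic] [W.IsGloballyMinimal] (κ₁ κ₂ : ZpExtension K p)
    (γ₁ γ₂ : absoluteGaloisGroup K) [Fact (ZpExtension.IsTopGeneratorPair κ₁ κ₂ γ₁ γ₂)] {N : ℕ}
    [NeZero N] (π : ModularParametrizationData W N) (hp : 3 < p) (hord : GoodOrd W p)
    (hK : IsImaginaryQuadratic K) (hHeeg : SatisfiesHeegnerHypothesis N K)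
    (hsplit : ((Ideal.span {(p : ℤ)}).primesOver (𝓞 K)).ncard = 2) (hodd : Odd (NumberField.discr K))
    (h3 : NumberField.discr K ≠ -3)
    (hN : ∀ ℓ : ℕ, ℓ.Prime → ℓ ^ 2 ∣ W.conductorNorm ℤ → ¬ p ∣ ℓ + 1) (hsur : Surj W p) :
    OrdinaryTwoVariableMainConjectureAt ι W K κ₁ κ₂ γ₁ γ₂ π :=
  of_thm141_of_surj h ι W κ₁ κ₂ γ₁ γ₂ π hp hord hK hHeeg hsplit hodd h3
    (vexingPrimes_eq_empty_of_forall_sq_dvd_not_dvd W hN) hsur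

/-- **The restricted sentence on the semistable (sur)-locus is a consequence of BCS Thm. 1.4.1 (b)**:
granted that named fact, statement 4.1.1 holds at every datum with `E` semistable, `p > 3` good
ordinary, (sur), `K` imaginary quadratic with (Heeg), (spl), (disc) — recorded as ONE implication
between typed objects (no hypothesis on `V` remains).
[cite: BurungaleCastellaSkinner2025, Thm. 1.4.1 (b) and statement 4.1.1 (pp. 4, 8 of arXiv:2405.00270v2)] -/
theorem statement_on_semistable_surj_locus (h : thm141_XOrd₂_isTorsion_charIdeal_eq_perrinRiou) :
    ∀ {p : ℕ} [Fact p.Prime] (ι : integralClosure ℚ ℂ →+* ℂ_[p]) (W : WeierstrassCurve ℚ)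
      [W.IsElliptic] [W.IsGloballyMinimal] (K : Type) [Field K] [NumberField K]
      (κ₁ κ₂ : ZpExtension K p) (γ₁ γ₂ : absoluteGaloisGroup K)
      [Fact (ZpExtension.IsTopGeneratorPair κ₁ κ₂ γ₁ γ₂)] {N : ℕ} [NeZero N]
      (π : ModularParametrizationData W N),
      3 < p → GoodOrd W p → IsImaginaryQuadratic K → SatisfiesHeegnerHypothesis N K →
        ((Ideal.span {(p : ℤ)}).primesOver (𝓞 K)).ncard = 2 → Odd (NumberField.discr K) →
        NumberField.discr K ≠ -3 → W.IsSemistable (𝓞 ℚ) → Surj W p →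
      OrdinaryTwoVariableMainConjectureAt ι W K κ₁ κ₂ γ₁ γ₂ π :=
  fun ι W _ _ _ _ _ κ₁ κ₂ γ₁ γ₂ _ _ _ π hp hord hK hHeeg hsplit hodd h3 hss hsur ↦
    of_thm141_of_surj_of_isSemistable h ι W κ₁ κ₂ γ₁ γ₂ π hp hord hK hHeeg hsplit hodd h3 hss hsur

end Summit.BirchSwinnertonDyer.Rank1Residual.TwoVariableIMC

end
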